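import Literature.Probability.LatticeModels.TriMeshTriCells
import Literature.Probability.LatticeModels.MeshWindows
import HarnessLib

/-!
# Windows of a column of the sheared triangular mesh and the decomposition of crossing counts

Topic: Probability / LatticeModels (triangular twin `TriMesh*` of the "largest mesh component =
bulk" series; sub-namespace `Literature.Probability.LatticeModels.TriMesh`; triangles of a column
are indexed by `n : ℤ` as in `TriMeshTriangles.lean`, the crossing edge `n` being the lower edge
of triangle `n`). For `Ω` with bounded shear preimage `Ω' = triLinear ⁻¹' Ω`, mesh `δ > 0` and a
column `k`, every index `j` sits in a unique **window** `(b, t]`: `b < j ≤ t`, the triangles `b`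
and `t` of column `k` are not perfect and all triangles strictly between them are perfect
(`exists_window`, `window_eq_of_mem`); far triangles are not even full, so windows exist. The
crossing edges of column `k` traversed by a `𝕋`-walk are then counted window by window
(`countP_isKCross_eq_sum`): a finite sum, over the bottoms `b` of the windows met, of the numbers
of traversed crossing edges `n` with `b < n ≤ t(b)` — the quantity shown to be even, window by
window, in `TriMeshTriParity.lean`.

Folklore bookkeeping (verbatim port of `MeshWindows.lean`). Mathlib anchors:
`Int.exists_greatest_of_bdd`, `Int.exists_least_of_bdd`, `List.countP`, `Finset.sum`. H21
anchors: `TriMesh.IsPerfect`, `TriMesh.IsFull`, `TriMesh.kcross`, `TriMesh.IsKCross`,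
`TriMesh.abs_le_of_isFull` (`TriMeshTriCells.lean`, `TriMeshTriangles.lean`).
-/

namespace Literature.Probability.LatticeModels.TriMesh

open Set Metric

noncomputable section

variable {Ω : Set ℂ} {δ : ℝ}

/-! ### Far triangles, and the window of an index -/

/-- In a domain with bounded shear preimage, below every index there is a non-perfect triangle of
column `k` (`δ > 0`). [folklore] -/
theorem exists_lt_not_isPerfect (hΩb : Bornology.IsBounded (triLinear ⁻¹' Ω)) (hδ : 0 < δ) (k j : ℤ) :
    ∃ i, i < j ∧ ¬ IsPerfect Ω δ k i := by
  obtain ⟨R, hR⟩ := (Metric.isBounded_iff_subset_closedBall (0 : ℂ)).1 hΩb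
  refine ⟨min (j - 1) (-(2 * ⌈(R + δ) / δ⌉ + 2)), by omega, fun h => ?_⟩
  have h1 := (abs_le_of_isFull hδ hR h.1).2
  set i := min (j - 1) (-(2 * ⌈(R + δ) / δ⌉ + 2)) with hi
  have hi' : (i : ℝ) ≤ (-(2 * ⌈(R + δ) / δ⌉ + 2) : ℤ) := by exact_mod_cast min_le_right _ _
  have hceil : (R + δ) / δ ≤ ⌈(R + δ) / δ⌉ := Int.le_ceil _
  have hR0 : 0 ≤ R + δ := by
    have := mul_nonneg hδ.le (abs_nonneg ((i : ℝ) / 2 + 1 / 4)); linarith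
  have hneg : (i : ℝ) / 2 + 1 / 4 < 0 := by
    have : (0 : ℝ) ≤ (R + δ) / δ := by positivity
    push_cast at hi'; linarith
  rw [abs_of_neg hneg] at h1
  have : δ * ((R + δ) / δ) ≤ δ * (-((i : ℝ) / 2 + 1 / 4)) := by
    apply mul_le_mul_of_nonneg_left _ hδ.le
    push_cast at hi'; linarith
  rw [mul_div_cancel₀ _ hδ.ne'] at this
  linarith

/-- In a domain with bounded shear preimage, at or above every index there is a non-perfect
triangle of column `k` (`δ > 0`). [folklore] -/
theorem exists_ge_not_isPerfect (hΩb : Bornology.IsBounded (triLinear ⁻¹' Ω)) (hδ : 0 < δ) (k j : ℤ) :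
    ∃ i, j ≤ i ∧ ¬ IsPerfect Ω δ k i := by
  obtain ⟨R, hR⟩ := (Metric.isBounded_iff_subset_closedBall (0 : ℂ)).1 hΩb
  refine ⟨max j (2 * ⌈(R + δ) / δ⌉ + 2), le_max_left _ _, fun h => ?_⟩
  have h1 := (abs_le_of_isFull hδ hR h.1).2
  set i := max j (2 * ⌈(R + δ) / δ⌉ + 2) with hi
  have hi' : ((2 * ⌈(R + δ) / δ⌉ + 2 : ℤ) : ℝ) ≤ i := by exact_mod_cast le_max_right _ _
  have hceil : (R + δ) / δ ≤ ⌈(R + δ) / δ⌉ := Int.le_ceil _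
  have hR0 : 0 ≤ R + δ := by
    have := mul_nonneg hδ.le (abs_nonneg ((i : ℝ) / 2 + 1 / 4)); linarith
  have hpos : (0 : ℝ) < (i : ℝ) / 2 + 1 / 4 := by
    have : (0 : ℝ) ≤ (R + δ) / δ := by positivity
    push_cast at hi'; linarith
  rw [abs_of_pos hpos] at h1
  have : δ * ((R + δ) / δ) ≤ δ * ((i : ℝ) / 2 + 1 / 4) := by
    apply mul_le_mul_of_nonneg_left _ hδ.le
    push_cast at hi'; linarith
  rw [mul_div_cancel₀ _ hδ.ne'] at this
  linarith

/-- **The window of an index.** For every `j` there are `b < j ≤ t` with the triangles `b` and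
`t` of column `k` not perfect and all triangles `i`, `b < i < t`, perfect. [folklore] -/
theorem exists_window (hΩb : Bornology.IsBounded (triLinear ⁻¹' Ω)) (hδ : 0 < δ) (k j : ℤ) :
    ∃ b t : ℤ, b < j ∧ j ≤ t ∧ ¬ IsPerfect Ω δ k b ∧ ¬ IsPerfect Ω δ k t ∧
      ∀ i, b < i → i < t → IsPerfect Ω δ k i := by
  classical
  obtain ⟨b, ⟨hbj, hbP⟩, hbmax⟩ := Int.exists_greatest_of_bdd (P := fun i => i < j ∧ ¬ IsPerfect Ω δ k i)
    ⟨j, fun i hi => hi.1.le⟩ (exists_lt_not_isPerfect hΩb hδ k j)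
  obtain ⟨t, ⟨hjt, htP⟩, htmin⟩ := Int.exists_least_of_bdd (P := fun i => j ≤ i ∧ ¬ IsPerfect Ω δ k i)
    ⟨j, fun i hi => hi.1⟩ (exists_ge_not_isPerfect hΩb hδ k j)
  refine ⟨b, t, hbj, hjt, hbP, htP, fun i hbi hit => ?_⟩
  by_contra hi
  rcases lt_or_ge i j with hij | hij
  · exact absurd (hbmax i ⟨hij, hi⟩) (by omega)
  · exact absurd (htmin i ⟨hij, hi⟩) (by omega)

/-- **Windows are determined by any index they contain.** [folklore] -/
theorem window_eq_of_mem {k b t b' t' j : ℤ} (hb : ¬ IsPerfect Ω δ k b) (ht : ¬ IsPerfect Ω δ k t)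
    (hin : ∀ i, b < i → i < t → IsPerfect Ω δ k i) (hb' : ¬ IsPerfect Ω δ k b')
    (ht' : ¬ IsPerfect Ω δ k t') (hin' : ∀ i, b' < i → i < t' → IsPerfect Ω δ k i)
    (h1 : b < j) (h2 : j ≤ t) (h1' : b' < j) (h2' : j ≤ t') : b = b' ∧ t = t' := by
  constructor
  · by_contra hne
    rcases lt_or_gt_of_ne hne with h | h
    · exact hb' (hin b' h (by omega))
    · exact hb (hin' b h (by omega))
  · by_contra hne
    rcases lt_or_gt_of_ne hne with h | h
    · exact ht (hin' t (by omega) h)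
    · exact ht' (hin t' (by omega) h)

/-! ### Decomposing the crossing count of a walk by windows -/

/-- Crossing edges of a column are determined by their index. [folklore] -/
theorem kcross_injective (k : ℤ) : Function.Injective (kcross k) := by
  intro n n' h
  rw [kcross, kcross, Sym2.eq_iff] at h
  rcases h with ⟨h1, h2⟩ | ⟨h1, -⟩
  · have a := congrFun h1 1
    have c := congrFun h2 1
    simp only [xL_one, xR_one] at a c
    have e1 := two_mul_cBot_add n
    have e2 := two_mul_cBot_add n'
    rw [cTop_eq, cTop_eq] at a
    omega
  · have := congrFun h1 0
    simp at this

open Classical in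
/-- **Counting crossing edges window by window.** Let `key : ℤ → ℤ` assign to each index the
bottom of its window (any function will do here) and let `B` be a finite set of integers
containing the keys of the indices of all crossing edges of column `k` in the list `L`. Then the
number of crossing edges of column `k` in `L` is the sum over `b ∈ B` of the numbers of crossing
edges `kcross k n` in `L` with `key n = b`. [folklore] -/
theorem countP_isKCross_eq_sum (k : ℤ) (key : ℤ → ℤ) (B : Finset ℤ) (L : List (Sym2 (Site 2)))
    (hB : ∀ e ∈ L, ∀ n, e = kcross k n → key n ∈ B) :
    L.countP (fun e => decide (IsKCross k e)) =
      ∑ b ∈ B, L.countP fun e => decide (∃ n, e = kcross k n ∧ key n = b) := by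
  induction L with
  | nil => simp
  | cons e L ih =>
    have hB' : ∀ e ∈ L, ∀ n, e = kcross k n → key n ∈ B := fun e he => hB e (List.mem_cons_of_mem _ he)
    rw [List.countP_cons, ih hB']
    simp only [List.countP_cons]
    rw [Finset.sum_add_distrib]
    congr 1
    by_cases hr : IsKCross k e
    · obtain ⟨n₀, rfl⟩ := hr
      have hkey : key n₀ ∈ B := hB _ List.mem_cons_self n₀ rfl
      have hiff : ∀ b, (∃ n, kcross k n₀ = kcross k n ∧ key n = b) ↔ key n₀ = b := by
        intro b
        constructor
        · rintro ⟨n, hn, rfl⟩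
          rw [kcross_injective k hn]
        · intro h
          exact ⟨n₀, rfl, h⟩
      have h1 : (if decide (IsKCross k (kcross k n₀)) = true then 1 else 0) = 1 := by
        simp [IsKCross]
      rw [h1]
      simp_rw [hiff, decide_eq_true_eq]
      rw [Finset.sum_ite_eq B (key n₀) (fun _ => (1 : ℕ)), if_pos hkey]
    · have h0 : (if decide (IsKCross k e) = true then 1 else 0) = 0 := by simp [hr]
      rw [h0]
      symm
      refine Finset.sum_eq_zero fun b _ => ?_
      have : ¬ ∃ n, e = kcross k n ∧ key n = b := by
        rintro ⟨n, rfl, -⟩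
        exact hr ⟨n, rfl⟩
      simp [this]

end

end Literature.Probability.LatticeModels.TriMesh
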